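import Literature.MathematicalPhysics.QuantumFieldTheory.Balaban1983to89.T4ShellMeasurePlaquette
import Summits.QuantumFields.BalabanUV.T4Continuum.Support.NE9FadingArithmetic
import Summits.QuantumFields.BalabanUV.T4Continuum.Support.NE9MarginalProjection

/-!
# NE9ProjectionCostBudget — row AW of the NE9 skeleton AT THE MODEL LEVEL (the one-cube Wilson action is SECOND order in the
# plaquette field, hence j-uniform) and the LOCATED FADING GAP WITH THE v1.3 PROJECTION COST `1 + cr·a` UNDER THE AW SHAPE
# `a ≤ c_A·M⁴`: the `M⁻⁴` of leaf N2's printed-letter verdict cancels — «M sufficiently large» no longer yields fading; the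
# p. 18 / «κ sufficiently large» route does, M-free (cell `pub-balaban`, T⁴ fan-out, `HOME/BINDER-OWNERS.md` row NE9; NE9
# formalisation swarm, unit `b2b-balaban-t4-ne9-formalise-leaf-04-g2`, journal FINDING F-ne9leaf04g2-1; LEAN PLACEMENT RULE
# 2026-08-19: our bookkeeping lives under `Summits/`)

HONEST FRAMING (T4-DAG PAGE 1).  The cell's T⁴ target is rung (B)+1 — existence AND uniqueness of the ε → 0 limit of
gauge-invariant expectations on a FIXED finite torus T⁴; NOT infinite volume, NOT a mass gap, NOT the Clay problem.  The spine
estimate NE9 (`T4OutputRate.NE9`) is NOT PRINTED in the audited series and NOT PROVED anywhere in the tree («NE9 ⇐ the named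
binders»).  This module is (§1) [folklore] normed-algebra bookkeeping and (§2–§3) real arithmetic over ABSTRACT letters and
HYPOTHESIS SHAPES; nothing of [I] = [Balaban1987RG1] / [II] = [Balaban1988RG2Cluster] is asserted — the locators say only which
printed sentence a hypothesis SHAPE types (ABSOLUTE RULE).  No `def … : Prop`; no END face re-wired; nothing instantiated on
Bałaban's objects (0/18 leaves instantiated; spine estimates PROVED 0/9 — both unchanged).  HONEST DEPENDENCY (cell, verbatim):
continuum YM on T⁴ ⇐ BetaPertH ∧ nine spine estimates (0/9 proved); BetaPertH ⇐ (D1) ∧ (D4) ∧ CAP+tail; G-an2-4 gates asym, D1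
and NE2/3/4.

CONTEXT.  The row owner's v1.3 correction (`Support/NE9MarginalProjection`, `…End`; skeleton `t4/b2b-balaban-t4-ne9-p1/
SKELETON-NE9-P1.md` v1.3.1 §3 rows RO/AW/N2) feeds the history channel MARGINAL-FREE old terms through the read-out projection
`margProj r A` at the price `1 + c`, `c = cr·a`, on the channel weight (`projSize_margProj`); the END faces' rate letter becomes
`ω′ = ω + 8·lipbar·B·((1 + cr·a)·τ̄)`.  `cr` = node U2's read-out constant (`T4BetaReadOutLipschitz.readBoundedOn_recipe`: 8K/α²;
NOT PRINTED, GAPS C-ne4p1-7); `a` = the size of the marginal direction (`DirSize A κ a`) = sup of the ONE-CUBE Wilson action over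
the analyticity domain — row AW: «ELEMENTARY (6(ML^j)⁴ plaquettes × |1 − Re tr U_p| ≲ (α₀+α₁)²L^{−4j} on the complex domain ⇒
a ≲ 6M⁴(α₀+α₁)², j-uniform); not yet typed».  Leaf N2's census (`Support/NE9FadingArithmetic`, leaf-10; sheet `HOME/t4/
b2b-balaban-t4-ne9-formalise-leaf-10/NE9FadingCensus.md` §3) priced the c = 0 gap in print's letters, `K·lipbar·B·τ̄ ≤
648·K·c₁c₂/M⁴` under p. 20 «(LM)⁴α₄ … bounded … by 1» and p. 21 «O(1)C₃ε₁ ≤ ½E₀» (`rateGap_le_of_printed`), whence «fading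
follows for every M with M⁴ > 648Kc⋆/(1 − L⁻¹)» (`fade_of_printed`).

WHAT IS PROVED (kernel; Mathlib + the three imports BY NAME; 0 `def`, 0 `sorry`, no new axiom).
§1 AW AT THE MODEL LEVEL.  In a complete normed ℂ-algebra with a trace-TYPE functional `τ` (`‖τ‖ ≤ 1`, `τ 1 = 1`: the NORMALIZED
trace of (0.2) p. 252 «tr is the normalized trace, i.e. tr 1 = 1») and a plaquette variable in Lie form `exp Y`, `τ Y = 0` (G
semisimple ⊂ U(N), pp. 251–252: traceless Lie algebra): `‖τ(exp Y) − 1‖ ≤ e^{‖Y‖} − 1 − ‖Y‖` (`norm_map_exp_sub_one_le`, via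
the tree's `T4ShellMeasurePlaquette.norm_exp_sub_one_sub_le`), likewise `1 − Re τ(exp Y)` (`abs_one_sub_re_map_exp_le`, `…_le_sq`:
`≤ ‖Y‖²` for `‖Y‖ ≤ 1`) and the inverse-symmetrised `½(τ(exp Y) + τ(exp(−Y)))` (`norm_symm_map_exp_sub_one_le`); for contrast
the FIRST-order route `‖τ U − 1‖ ≤ ‖U − 1‖` (`norm_map_sub_one_le`).  ONE CUBE: `|Σ_{p∈P}(1 − Re τ(exp Y_p))| ≤ #P·r²` for
`‖Y_p‖ ≤ r ≤ 1` (`abs_cubeSum_le`); j-UNIFORMITY (`abs_cubeSum_le_uniform`): `#P ≤ 6·(M·L^j)⁴` and `‖Y_p‖ ≤ r₀/(L^j)²` — the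
SHAPE of (1.14) p. 262 «|∂𝐔 − 1| < α₀ξ²», ξ = L^{−j} — give `|A_□| ≤ 6·M⁴·r₀²`, j-FREE, whereas the first-order count
`6(M·L^j)⁴·(α₀/(L^j)²) = 6α₀M⁴(L^j)²` (`firstOrder_count`) is NOT — the second order is load-bearing.  `dirSize_of_cubes`: a
direction vanishing off the tree-length-0 domains and bounded by `a ≥ 0` there satisfies the owner's `DirSize A κ a` for every κ.
§2 THE LOCATED GAP WITH THE PROJECTION COST UNDER THE AW SHAPE (letters of the leaf-10 census; `a ≤ c_A·M⁴`, `cr, c_A ≥ 0`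
hypothesis SHAPES): `rateGap_le_of_printed_AW` — `K·(c₁α₄/E₀)·B·((1 + cr·a)·(c₂(6L)⁴)) ≤ 648·K·c₁c₂·(1/M⁴ + cr·c_A)`;
`room_AW_iff`; **(V1) `not_rescued_by_M`** — the room clause `648Kc₁c₂(1 + cr·c_A·M⁴) < (1 − 1/L)M⁴` IMPLIES the M-FREE
necessary condition `648·K·c₁c₂·cr·c_A < 1 − 1/L`: no M yields fading from p. 20/p. 21 alone once `cr·c_A·c₁c₂ ≥ (1 − L⁻¹)/
(648K)` (`fade_of_printed_AW` = the positive statement under the AW room); **(V2)** keeping the budget's ε₁: `rateGap_le_budget_AW`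
(`≤ 1296Kc₁c₂(1/M⁴ + cr·c_A)·(B/E₀)`, p. 20 only), `fade_of_budget_AW` (fading ⇐ `B/E₀ < (1 − 1/L)/(1296Kc₁c₂(1/M⁴ + cr·c_A))` —
p. 21's own TYPE «we can take E₀ such that the assumption is satisfied», DEFINITE constant), `fade_of_p18_AW` (with `B = c_B·C₃ε₁`
and the CONCLUSION SHAPE of leaf-10's `budget_le_of_p18`, `C₃ε₁ ≤ 2(L+2)⁴c′e^{−5κ}`: fading ⇐ the κ-CLAUSE `2592·K·c₁c₂·c′·c_B·
(L+2)⁴·(1/M⁴ + cr·c_A)·e^{−5κ} < (1 − 1/L)·E₀` — TYPE «κ sufficiently large», p. 18; `kappaClause_iff`, `kappaClause_mono`).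
§3 NUMERIC CORNERS (`norm_num` + Mathlib's decimal bounds on `e`): (V1) at L = 13: `c₁c₂·cr·c_A < 1/5616` (K = 8), `< 1/2808`
(K = 4); (V2) at K = 8, L = M = 13, c₁c₂ = c′ = c_B = E₀ = cr·c_A = 1: the κ-clause FAILS at κ = 4 and HOLDS at κ = 5 (c = 0
value: κ_min = 3, leaf-10's Table C).  Two external engines (`kit` j089643 Python `fractions`, j089644 PARI/GP, tag balaban)
reproduce the table (κ_min = 5/5/6/7/7 at cr·c_A = 1/10/192/10⁴/10⁶, identical at M = 13 and M = 169); sheet `HOME/t4/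
b2b-balaban-t4-ne9-formalise-leaf-04/NE9ProjectionCostCensus.md`.

READING (census-class, F-ne9leaf04g2-1; no landed theorem affected).  On the v1.3 dictionary leaf N2's verdict «fading … follows
from p. 20/p. 21 once M⁴ > 648Kc⋆/(1 − L⁻¹)» must be re-read: with B bounded only by ½E₀ it does NOT follow for any M (V1);
with B = c_B·C₃ε₁ it follows from p. 20 + p. 18 + «κ ≥ κ_min», κ_min M-free and logarithmic in the projection cost (V2) — no
smallness BEYOND the TYPE of print's standing assumptions, but the operative sentence moves from p. 21/«M large» to p. 18/«κ
large», and the unprinted `cr` now sits inside NE9's κ-threshold.  Row AW on Bałaban's 𝔘^c_j(□, α₀, α₁) (the owner's (w9), with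
O1) and `cr` on the (1.20) probes ((w8)) remain OPEN and are NOT touched here; print has no numerics for c₁, c₂, c′, c_B, cr.

References (TYPES/STRUCTURE only): [Balaban1987RG1] CMP 109 (1987) pp. 251–252 (G ⊂ U(N) semisimple; (0.2) Wilson action,
normalized trace), (1.11)–(1.14) p. 262 (𝔘^c_j), (1.3) p. 260, (1.18) p. 263 — renders `HOME/b2b-balaban-ref1/pages/1987-cmp109-
rg-I-small-field/…-p003/p004/p014-x2.png` re-read as images by this seat; [Balaban1988RG2Cluster] CMP 116 (1988) (1.36) p. 9,
(2.18)–(2.20) p. 16, p. 18, p. 20, (2.41) p. 21 via the census sheet's located quotations.  Provenance: NE9 swarm leaf-04 gen 2,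
2026-08-20.
-/

noncomputable section

namespace Summit.QuantumFields.BalabanUV.T4Continuum.NE9ProjectionCostBudget

open NormedSpace
open Literature.MathematicalPhysics.QuantumFieldTheory.Balaban1983to89
open Literature.MathematicalPhysics.QuantumFieldTheory.Balaban1983to89.T4ShellMeasurePlaquette
open Literature.MathematicalPhysics.QuantumFieldTheory.Balaban1983to89.T4OutputRate
open Summit.QuantumFields.BalabanUV.T4Continuum.NE9FadingArithmetic
open Summit.QuantumFields.BalabanUV.T4Continuum.NE9MarginalProjection

/-! ## §1 Row AW at the model level: the plaquette cost is second order, the one-cube sum is j-uniform -/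

section Plaquette

variable {A : Type*} [NormedRing A] [NormedAlgebra ℂ A] [CompleteSpace A]

omit [CompleteSpace A] in
/-- FIRST-ORDER ROUTE (for contrast): a trace-type functional of norm `≤ 1` with `τ 1 = 1` satisfies `‖τ U − 1‖ ≤ ‖U − 1‖` —
with the SHAPE of (1.14) p. 262 «|∂𝐔 − 1| < α₀ξ²» this is first order in `ξ² = L^{−2j}` only. [cite: Balaban1987RG1, (1.14) p.262] -/
theorem norm_map_sub_one_le (τ : A →L[ℂ] ℂ) (hτ : ‖τ‖ ≤ 1) (h1 : τ 1 = 1) (U : A) : ‖τ U - 1‖ ≤ ‖U - 1‖ := by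
  have h : τ U - 1 = τ (U - 1) := by rw [map_sub, h1]
  rw [h]
  calc ‖τ (U - 1)‖ ≤ ‖τ‖ * ‖U - 1‖ := τ.le_opNorm _
    _ ≤ 1 * ‖U - 1‖ := mul_le_mul_of_nonneg_right hτ (norm_nonneg _)
    _ = ‖U - 1‖ := one_mul _

/-- **THE PLAQUETTE COST IS SECOND ORDER.**  For a trace-type functional `τ` (`‖τ‖ ≤ 1`, `τ 1 = 1` — the normalized trace of
(0.2) p. 252) and a plaquette variable in Lie form `exp Y` with `τ Y = 0` (traceless Lie algebra, G semisimple ⊂ U(N),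
pp. 251–252; the complexified 𝔤^c of p. 252 is traceless too): `‖τ(exp Y) − 1‖ ≤ e^{‖Y‖} − 1 − ‖Y‖` — the linear term drops by
`τ Y = 0`.  Hypothesis SHAPES only. [cite: Balaban1987RG1, (0.2) p.252] -/
theorem norm_map_exp_sub_one_le (τ : A →L[ℂ] ℂ) (hτ : ‖τ‖ ≤ 1) (h1 : τ 1 = 1) {Y : A} (hY : τ Y = 0) :
    ‖τ (exp Y) - 1‖ ≤ expTail₂ ‖Y‖ := by
  have h : τ (exp Y) - 1 = τ (exp Y - 1 - Y) := by rw [map_sub, map_sub, h1, hY, sub_zero]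
  rw [h]
  calc ‖τ (exp Y - 1 - Y)‖ ≤ ‖τ‖ * ‖exp Y - 1 - Y‖ := τ.le_opNorm _
    _ ≤ 1 * (Real.exp ‖Y‖ - 1 - ‖Y‖) :=
        mul_le_mul hτ (norm_exp_sub_one_sub_le Y) (norm_nonneg _) zero_le_one
    _ = expTail₂ ‖Y‖ := by rw [one_mul]; rfl

/-- The Wilson plaquette cost `1 − Re τ(exp Y)` ((0.2) p. 252, `d = 4`) is second order: `≤ e^{‖Y‖} − 1 − ‖Y‖`.
[cite: Balaban1987RG1, (0.2) p.252] -/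
theorem abs_one_sub_re_map_exp_le (τ : A →L[ℂ] ℂ) (hτ : ‖τ‖ ≤ 1) (h1 : τ 1 = 1) {Y : A} (hY : τ Y = 0) :
    |1 - (τ (exp Y)).re| ≤ expTail₂ ‖Y‖ := by
  have h : 1 - (τ (exp Y)).re = -((τ (exp Y) - 1).re) := by simp
  rw [h, abs_neg]
  exact (Complex.abs_re_le_norm _).trans (norm_map_exp_sub_one_le τ hτ h1 hY)

/-- The square form: `|1 − Re τ(exp Y)| ≤ ‖Y‖²` for `‖Y‖ ≤ 1`. [folklore] -/
theorem abs_one_sub_re_map_exp_le_sq (τ : A →L[ℂ] ℂ) (hτ : ‖τ‖ ≤ 1) (h1 : τ 1 = 1) {Y : A} (hY : τ Y = 0)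
    (hY1 : ‖Y‖ ≤ 1) : |1 - (τ (exp Y)).re| ≤ ‖Y‖ ^ 2 :=
  (abs_one_sub_re_map_exp_le τ hτ h1 hY).trans
    (expTail₂_le_sq (by rwa [abs_of_nonneg (norm_nonneg Y)]))

/-- The inverse-symmetrised analytic continuation of the plaquette cost, `½(τ(exp Y) + τ(exp(−Y))) − 1`, is second order too
(same bound; `‖−Y‖ = ‖Y‖`). [folklore] -/
theorem norm_symm_map_exp_sub_one_le (τ : A →L[ℂ] ℂ) (hτ : ‖τ‖ ≤ 1) (h1 : τ 1 = 1) {Y : A} (hY : τ Y = 0) :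
    ‖(τ (exp Y) + τ (exp (-Y))) / 2 - 1‖ ≤ expTail₂ ‖Y‖ := by
  have hY' : τ (-Y) = 0 := by rw [map_neg, hY, neg_zero]
  have h : (τ (exp Y) + τ (exp (-Y))) / 2 - 1 = ((τ (exp Y) - 1) + (τ (exp (-Y)) - 1)) / 2 := by ring
  rw [h, norm_div, Complex.norm_two, div_le_iff₀ (by norm_num : (0 : ℝ) < 2)]
  calc ‖(τ (exp Y) - 1) + (τ (exp (-Y)) - 1)‖ ≤ ‖τ (exp Y) - 1‖ + ‖τ (exp (-Y)) - 1‖ := norm_add_le _ _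
    _ ≤ expTail₂ ‖Y‖ + expTail₂ ‖-Y‖ :=
        add_le_add (norm_map_exp_sub_one_le τ hτ h1 hY) (norm_map_exp_sub_one_le τ hτ h1 hY')
    _ = expTail₂ ‖Y‖ * 2 := by rw [norm_neg]; ring

/-- **ONE CUBE.**  The Wilson action of a finite set `P` of plaquettes whose variables are `exp Y_p`, `τ Y_p = 0`, `‖Y_p‖ ≤ r ≤ 1`:
`|Σ_{p∈P} (1 − Re τ(exp Y_p))| ≤ #P·r²`. [folklore] -/
theorem abs_cubeSum_le (τ : A →L[ℂ] ℂ) (hτ : ‖τ‖ ≤ 1) (h1 : τ 1 = 1) {ι : Type*} (P : Finset ι) (Y : ι → A) {r : ℝ}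
    (hY0 : ∀ p ∈ P, τ (Y p) = 0) (hYr : ∀ p ∈ P, ‖Y p‖ ≤ r) (hr1 : r ≤ 1) :
    |∑ p ∈ P, (1 - (τ (exp (Y p))).re)| ≤ P.card * r ^ 2 := by
  calc |∑ p ∈ P, (1 - (τ (exp (Y p))).re)| ≤ ∑ p ∈ P, |1 - (τ (exp (Y p))).re| := Finset.abs_sum_le_sum_abs _ _
    _ ≤ ∑ _p ∈ P, r ^ 2 := Finset.sum_le_sum fun p hp => by
        have hr0 : 0 ≤ r := (norm_nonneg _).trans (hYr p hp)
        calc |1 - (τ (exp (Y p))).re| ≤ expTail₂ ‖Y p‖ := abs_one_sub_re_map_exp_le τ hτ h1 (hY0 p hp)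
          _ ≤ expTail₂ r := expTail₂_mono (norm_nonneg _) (hYr p hp)
          _ ≤ r ^ 2 := expTail₂_le_sq (by rwa [abs_of_nonneg hr0])
    _ = P.card * r ^ 2 := by rw [Finset.sum_const, nsmul_eq_mul]

/-- **ROW AW'S j-UNIFORMITY, MODEL LEVEL.**  With at most `6·(M·L^j)⁴` plaquettes in a cube of the scale-j partition (side `M·L^j`
sites of the `ξ = L^{−j}` lattice, 6 plaquette orientations per site in d = 4) and the SHAPE of (1.14) p. 262 «|∂𝐔 − 1| < α₀ξ²»
read in Lie form as `‖Y_p‖ ≤ r₀/(L^j)²` (`r₀/(L^j)² ≤ 1`), the one-cube Wilson action is `≤ 6·M⁴·r₀²` — independent of j.  (The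
identification of Bałaban's 𝔘^c_j(□, α₀, α₁) with these shapes is row AW proper, the owner's (w9) with O1; NOT done here.)
[cite: Balaban1987RG1, (1.11)-(1.14) p.262] -/
theorem abs_cubeSum_le_uniform (τ : A →L[ℂ] ℂ) (hτ : ‖τ‖ ≤ 1) (h1 : τ 1 = 1) {ι : Type*} (P : Finset ι) (Y : ι → A)
    {M L r₀ : ℝ} {j : ℕ} (hL : 0 < L) (hP : (P.card : ℝ) ≤ 6 * (M * L ^ j) ^ 4) (hY0 : ∀ p ∈ P, τ (Y p) = 0)
    (hYr : ∀ p ∈ P, ‖Y p‖ ≤ r₀ / (L ^ j) ^ 2) (hsmall : r₀ / (L ^ j) ^ 2 ≤ 1) :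
    |∑ p ∈ P, (1 - (τ (exp (Y p))).re)| ≤ 6 * M ^ 4 * r₀ ^ 2 := by
  have hLj : 0 < L ^ j := pow_pos hL j
  have h := abs_cubeSum_le τ hτ h1 P Y hY0 hYr hsmall
  have hr2 : 0 ≤ (r₀ / (L ^ j) ^ 2) ^ 2 := sq_nonneg _
  calc |∑ p ∈ P, (1 - (τ (exp (Y p))).re)| ≤ P.card * (r₀ / (L ^ j) ^ 2) ^ 2 := h
    _ ≤ 6 * (M * L ^ j) ^ 4 * (r₀ / (L ^ j) ^ 2) ^ 2 := mul_le_mul_of_nonneg_right hP hr2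
    _ = 6 * M ^ 4 * r₀ ^ 2 := by field_simp

/-- For contrast, the FIRST-order count: `6·(M·L^j)⁴` plaquettes × `α₀/(L^j)²` each `= 6α₀M⁴(L^j)²` — grows like `L^{2j}`, NOT
j-uniform; the second order (`abs_cubeSum_le_uniform`) is load-bearing for row AW. [folklore] -/
theorem firstOrder_count {M L α₀ : ℝ} {j : ℕ} (hL : L ≠ 0) :
    6 * (M * L ^ j) ^ 4 * (α₀ / (L ^ j) ^ 2) = 6 * α₀ * M ^ 4 * (L ^ j) ^ 2 := by
  have hLj : L ^ j ≠ 0 := pow_ne_zero j hL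
  field_simp

end Plaquette

section DirSizeOfCubes

variable {C : Carriers} {Bg : Type}

/-- **`DirSize` FROM A ONE-CUBE BOUND.**  A marginal direction `A` that vanishes off the domains of tree length 0 (the single
cubes of each scale, where the Wilson action `A^η` of (1.3) p. 260 is distributed) and is bounded by `a ≥ 0` there satisfies the
owner's binder `NE9MarginalProjection.DirSize A κ a` for every rate κ (`e^{−κ·0} = 1`). [cite: Balaban1987RG1, (1.3) p.260 and (1.18) p.263] -/
theorem dirSize_of_cubes {A : Bg → C.Dom → ℝ} {κ a : ℝ} (hcube : ∀ (U : Bg) (X : C.Dom), A U X ≠ 0 → C.d X = 0)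
    (hbound : ∀ (U : Bg) (X : C.Dom), |A U X| ≤ a) (ha : 0 ≤ a) : DirSize A κ a := by
  intro U X
  by_cases h : A U X = 0
  · rw [h, abs_zero]
    exact mul_nonneg ha (Real.exp_pos _).le
  · rw [hcube U X h, mul_zero, neg_zero, Real.exp_zero, mul_one]
    exact hbound U X

end DirSizeOfCubes

/-! ## §2 The located fading gap with the projection cost `1 + cr·a` under the AW shape `a ≤ c_A·M⁴` -/

section Located

/-- **THE GAP IN PRINT'S LETTERS WITH THE PROJECTION COST, UNDER THE AW SHAPE.**  Leaf-10's `rateGap_le_of_printed` (lipbar =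
`c₁α₄/E₀`, τ̄ = `c₂(6L)⁴`, p. 20 `(LM)⁴α₄ ≤ 1`, p. 21 `B ≤ E₀/2` typed as hypotheses) multiplied by the v1.3 cost `1 + cr·a`
with `a ≤ c_A·M⁴` (row AW's SHAPE «a ≲ 6M⁴(α₀+α₁)²», NOT PRINTED, not asserted): `K·lipbar·B·((1 + cr·a)·τ̄) ≤ 648·K·c₁c₂·
(1/M⁴ + cr·c_A)` — the `M⁻⁴` survives only in the first addend.  Hypothesis shapes only; nothing of [II] asserted.
[cite: Balaban1988RG2Cluster, (1.36) p.9, (2.18)-(2.20) p.16, p.20, (2.41) p.21] -/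
theorem rateGap_le_of_printed_AW {K L M α₄ E₀ B c₁ c₂ cr a c_A : ℝ} (hK : 0 ≤ K) (hM : 0 < M) (hE : 0 < E₀) (hB : 0 ≤ B)
    (hc₁ : 0 ≤ c₁) (hc₂ : 0 ≤ c₂) (hα₄ : 0 ≤ α₄) (h20 : (L * M) ^ 4 * α₄ ≤ 1) (h21 : B ≤ E₀ / 2) (hcr : 0 ≤ cr)
    (hcA : 0 ≤ c_A) (ha : a ≤ c_A * M ^ 4) :
    K * (c₁ * α₄ / E₀) * B * ((1 + cr * a) * (c₂ * (6 * L) ^ 4)) ≤ 648 * K * (c₁ * c₂) * (1 / M ^ 4 + cr * c_A) := by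
  have hbase := rateGap_le_of_printed (K := K) (L := L) hK hM hE hB hc₁ hc₂ h20 h21
  have hM4 : 0 < M ^ 4 := by positivity
  have hL4 : 0 ≤ (6 * L) ^ 4 := by positivity
  have hgap0 : 0 ≤ K * (c₁ * α₄ / E₀) * B * (c₂ * (6 * L) ^ 4) := by positivity
  have hcost : 1 + cr * a ≤ 1 + cr * (c_A * M ^ 4) := by nlinarith
  have hcost0 : 0 ≤ 1 + cr * (c_A * M ^ 4) := by positivity
  calc K * (c₁ * α₄ / E₀) * B * ((1 + cr * a) * (c₂ * (6 * L) ^ 4))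
      = K * (c₁ * α₄ / E₀) * B * (c₂ * (6 * L) ^ 4) * (1 + cr * a) := by ring
    _ ≤ K * (c₁ * α₄ / E₀) * B * (c₂ * (6 * L) ^ 4) * (1 + cr * (c_A * M ^ 4)) :=
        mul_le_mul_of_nonneg_left hcost hgap0
    _ ≤ 648 * K * (c₁ * c₂) / M ^ 4 * (1 + cr * (c_A * M ^ 4)) := mul_le_mul_of_nonneg_right hbase hcost0
    _ = 648 * K * (c₁ * c₂) * (1 / M ^ 4 + cr * c_A) := by field_simp

/-- The room clause of `fade_of_printed` with the projection cost under the AW shape, divided by `M⁴ > 0`: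
`648Kc₁c₂(1 + cr·c_A·M⁴) < (1 − 1/L)M⁴ ↔ 648Kc₁c₂(1/M⁴ + cr·c_A) < 1 − 1/L`. [folklore] -/
theorem room_AW_iff {K L M c₁ c₂ cr c_A : ℝ} (hM : 0 < M) :
    648 * K * (c₁ * c₂) * (1 + cr * c_A * M ^ 4) < (1 - 1 / L) * M ^ 4 ↔
      648 * K * (c₁ * c₂) * (1 / M ^ 4 + cr * c_A) < 1 - 1 / L := by
  have hM4 : 0 < M ^ 4 := by positivity
  have key : 648 * K * (c₁ * c₂) * (1 / M ^ 4 + cr * c_A) = 648 * K * (c₁ * c₂) * (1 + cr * c_A * M ^ 4) / M ^ 4 := by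
    field_simp
  rw [key, div_lt_iff₀ hM4]

/-- **(V1) «M SUFFICIENTLY LARGE» NO LONGER YIELDS FADING.**  The room clause with the projection cost under the AW shape IMPLIES
the M-FREE necessary condition `648·K·c₁c₂·cr·c_A < 1 − 1/L` (the addend `648Kc₁c₂/M⁴` is nonnegative): if `cr·c_A·c₁c₂ ≥
(1 − L⁻¹)/(648K)`, NO choice of M makes the clause true.  Real arithmetic; nothing printed asserted. [folklore] -/
theorem not_rescued_by_M {K L M c₁ c₂ cr c_A : ℝ} (hK : 0 ≤ K) (hM : 0 < M) (hc₁ : 0 ≤ c₁) (hc₂ : 0 ≤ c₂)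
    (hroom : 648 * K * (c₁ * c₂) * (1 + cr * c_A * M ^ 4) < (1 - 1 / L) * M ^ 4) :
    648 * K * (c₁ * c₂) * (cr * c_A) < 1 - 1 / L := by
  have h := (room_AW_iff (K := K) (L := L) (c₁ := c₁) (c₂ := c₂) (cr := cr) (c_A := c_A) hM).mp hroom
  have hM4 : 0 < M ^ 4 := by positivity
  have h0 : 0 ≤ 648 * K * (c₁ * c₂) * (1 / M ^ 4) := by positivity
  nlinarith

/-- **FADING FROM p. 20/p. 21 UNDER THE AW ROOM** (the positive statement): the hypotheses of `rateGap_le_of_printed_AW` and the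
room `648Kc₁c₂(1/M⁴ + cr·c_A) < 1 − 1/L` give `1/L + K·lipbar·B·((1 + cr·a)·τ̄) < 1` — for K = 8 literally the rate letter
`ω′ = ω + 8·lipbar·B·((1 + c)·τ̄)` of `NE9MarginalProjectionEnd` at `ω = L⁻¹`, `c = cr·a`.  By (V1) the room is a condition on
`cr·c_A·c₁c₂`, not on M. [cite: Balaban1988RG2Cluster, p.20, p.21] -/
theorem fade_of_printed_AW {K L M α₄ E₀ B c₁ c₂ cr a c_A : ℝ} (hK : 0 ≤ K) (hM : 0 < M) (hE : 0 < E₀) (hB : 0 ≤ B)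
    (hc₁ : 0 ≤ c₁) (hc₂ : 0 ≤ c₂) (hα₄ : 0 ≤ α₄) (h20 : (L * M) ^ 4 * α₄ ≤ 1) (h21 : B ≤ E₀ / 2) (hcr : 0 ≤ cr)
    (hcA : 0 ≤ c_A) (ha : a ≤ c_A * M ^ 4) (hroom : 648 * K * (c₁ * c₂) * (1 / M ^ 4 + cr * c_A) < 1 - 1 / L) :
    1 / L + K * (c₁ * α₄ / E₀) * B * ((1 + cr * a) * (c₂ * (6 * L) ^ 4)) < 1 := by
  have h := rateGap_le_of_printed_AW hK hM hE hB hc₁ hc₂ hα₄ h20 h21 hcr hcA ha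
  linarith

/-- **(V2, p. 20 only) THE GAP WITH THE BUDGET KEPT EXPLICIT.**  Without p. 21's `B ≤ E₀/2`: `K·lipbar·B·((1 + cr·a)·τ̄) ≤
1296·K·c₁c₂·(1/M⁴ + cr·c_A)·(B/E₀)` — one power of the (2.41) budget `B` (↔ `O(1)C₃ε₁`) survives, to be spent on the
projection cost. [cite: Balaban1988RG2Cluster, p.20, (2.41) p.21] -/
theorem rateGap_le_budget_AW {K L M α₄ E₀ B c₁ c₂ cr a c_A : ℝ} (hK : 0 ≤ K) (hM : 0 < M) (hE : 0 < E₀) (hB : 0 ≤ B)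
    (hc₁ : 0 ≤ c₁) (hc₂ : 0 ≤ c₂) (hα₄ : 0 ≤ α₄) (h20 : (L * M) ^ 4 * α₄ ≤ 1) (hcr : 0 ≤ cr) (hcA : 0 ≤ c_A)
    (ha : a ≤ c_A * M ^ 4) :
    K * (c₁ * α₄ / E₀) * B * ((1 + cr * a) * (c₂ * (6 * L) ^ 4)) ≤
      1296 * K * (c₁ * c₂) * (1 / M ^ 4 + cr * c_A) * (B / E₀) := by
  have hM4 : 0 < M ^ 4 := by positivity
  have h1 : L ^ 4 * α₄ ≤ 1 / M ^ 4 := by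
    rw [le_div_iff₀ hM4]
    calc L ^ 4 * α₄ * M ^ 4 = (L * M) ^ 4 * α₄ := by ring
      _ ≤ 1 := h20
  have hBE : 0 ≤ B / E₀ := div_nonneg hB hE.le
  have hLα : 0 ≤ L ^ 4 * α₄ := mul_nonneg (by positivity) hα₄
  have hcost : 1 + cr * a ≤ 1 + cr * (c_A * M ^ 4) := by nlinarith
  have hcost0 : 0 ≤ 1 + cr * (c_A * M ^ 4) := by positivity
  calc K * (c₁ * α₄ / E₀) * B * ((1 + cr * a) * (c₂ * (6 * L) ^ 4))
      = 1296 * K * (c₁ * c₂) * (L ^ 4 * α₄) * (B / E₀) * (1 + cr * a) := by ring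
    _ ≤ 1296 * K * (c₁ * c₂) * (L ^ 4 * α₄) * (B / E₀) * (1 + cr * (c_A * M ^ 4)) :=
        mul_le_mul_of_nonneg_left hcost (by positivity)
    _ ≤ 1296 * K * (c₁ * c₂) * (1 / M ^ 4) * (B / E₀) * (1 + cr * (c_A * M ^ 4)) := by gcongr
    _ = 1296 * K * (c₁ * c₂) * (1 / M ^ 4 + cr * c_A) * (B / E₀) := by field_simp

/-- **(V2) FADING FROM THE BUDGET'S SMALLNESS** — a clause of p. 21's own TYPE («O(1)C₃ε₁ ≤ ½E₀ … the constant C₃ε₁ is small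
anyway, and we can take E₀ such, that the assumption is satisfied») with a DEFINITE constant carrying the projection cost:
`B/E₀ < (1 − 1/L)/(1296Kc₁c₂(1/M⁴ + cr·c_A))` ⇒ `1/L + K·lipbar·B·((1 + cr·a)·τ̄) < 1`. [cite: Balaban1988RG2Cluster, p.20, p.21] -/
theorem fade_of_budget_AW {K L M α₄ E₀ B c₁ c₂ cr a c_A : ℝ} (hK : 0 ≤ K) (hM : 0 < M) (hE : 0 < E₀) (hB : 0 ≤ B)
    (hc₁ : 0 ≤ c₁) (hc₂ : 0 ≤ c₂) (hα₄ : 0 ≤ α₄) (h20 : (L * M) ^ 4 * α₄ ≤ 1) (hcr : 0 ≤ cr) (hcA : 0 ≤ c_A)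
    (ha : a ≤ c_A * M ^ 4) (hX : 0 < 1296 * K * (c₁ * c₂) * (1 / M ^ 4 + cr * c_A))
    (hsmall : B / E₀ < (1 - 1 / L) / (1296 * K * (c₁ * c₂) * (1 / M ^ 4 + cr * c_A))) :
    1 / L + K * (c₁ * α₄ / E₀) * B * ((1 + cr * a) * (c₂ * (6 * L) ^ 4)) < 1 := by
  have h := rateGap_le_budget_AW hK hM hE hB hc₁ hc₂ hα₄ h20 hcr hcA ha
  have h' : 1296 * K * (c₁ * c₂) * (1 / M ^ 4 + cr * c_A) * (B / E₀) < 1 - 1 / L := by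
    rw [lt_div_iff₀ hX] at hsmall
    linarith
  linarith

/-- The κ-CLAUSE of (V2) read as a threshold: `T·e^{−5κ} < R ↔ T < R·e^{5κ}` (`T`, `R` the two sides' ε₁-free letters). [folklore] -/
theorem kappaClause_iff {T R κ : ℝ} : T * Real.exp (-(5 * κ)) < R ↔ T < R * Real.exp (5 * κ) := by
  have hE : 0 < Real.exp (5 * κ) := Real.exp_pos _
  have hinv : Real.exp (-(5 * κ)) = (Real.exp (5 * κ))⁻¹ := Real.exp_neg _
  rw [hinv, ← div_eq_mul_inv, div_lt_iff₀ hE]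

/-- The κ-clause is MONOTONE in κ: TYPE «κ sufficiently large» (p. 18 «For κ sufficiently large and α₆ sufficiently small»).
[cite: Balaban1988RG2Cluster, p.18] -/
theorem kappaClause_mono {T R κ κ' : ℝ} (hT : 0 ≤ T) (hκ : κ ≤ κ') (h : T * Real.exp (-(5 * κ)) < R) :
    T * Real.exp (-(5 * κ')) < R := by
  have hle : Real.exp (-(5 * κ')) ≤ Real.exp (-(5 * κ)) := Real.exp_le_exp.mpr (by linarith)
  exact lt_of_le_of_lt (mul_le_mul_of_nonneg_left hle hT) h

/-- **(V2) FADING FROM p. 20 + p. 18 + «κ LARGE», M-FREE IN THE PROJECTION TERM.**  With the budget in C₃'s letters, `B = c_B·C₃ε₁`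
(`C3e` below stands for the product `C₃ε₁`), the CONCLUSION SHAPE of leaf-10's `budget_le_of_p18` — `C₃ε₁ ≤ 2(L+2)⁴·c′·e^{−5κ}`
(C₃'s definition p. 20 «C₃ = 2(L+2)⁴O(1)2E₀C₁α₄⁻¹α₆⁻¹M^q exp C₂κ₁» + p. 18 «Assuming 2E₀ε₁C₁α₄⁻¹α₆⁻¹M^q exp C₂κ₁ exp 5κ ≤ 1»)
— and the κ-CLAUSE `2592·K·c₁c₂·c′·c_B·(L+2)⁴·(1/M⁴ + cr·c_A)·e^{−5κ} < (1 − 1/L)·E₀`, the corrected rate fades: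
`1/L + K·lipbar·B·((1 + cr·a)·τ̄) < 1`.  M enters only through the vanishing addend `1/M⁴` (engines: κ_min identical at M = L
and M = L²).  Hypothesis shapes only. [cite: Balaban1988RG2Cluster, p.18, p.20, (2.41) p.21] -/
theorem fade_of_p18_AW {K L M α₄ E₀ B c₁ c₂ cr a c_A c_B c' C3e κ : ℝ} (hK : 0 ≤ K) (hM : 0 < M) (hE : 0 < E₀)
    (hc₁ : 0 ≤ c₁) (hc₂ : 0 ≤ c₂) (hα₄ : 0 ≤ α₄) (h20 : (L * M) ^ 4 * α₄ ≤ 1) (hcr : 0 ≤ cr) (hcA : 0 ≤ c_A)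
    (ha : a ≤ c_A * M ^ 4) (hcB : 0 ≤ c_B) (hC3e : 0 ≤ C3e) (hB : B = c_B * C3e)
    (h18 : C3e ≤ 2 * (L + 2) ^ 4 * c' * Real.exp (-(5 * κ)))
    (hκ : 2592 * K * (c₁ * c₂) * c' * c_B * (L + 2) ^ 4 * (1 / M ^ 4 + cr * c_A) * Real.exp (-(5 * κ)) <
      (1 - 1 / L) * E₀) :
    1 / L + K * (c₁ * α₄ / E₀) * B * ((1 + cr * a) * (c₂ * (6 * L) ^ 4)) < 1 := by
  have hB0 : 0 ≤ B := by rw [hB]; exact mul_nonneg hcB hC3e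
  have h := rateGap_le_budget_AW hK hM hE hB0 hc₁ hc₂ hα₄ h20 hcr hcA ha
  have hX0 : 0 ≤ 1296 * K * (c₁ * c₂) * (1 / M ^ 4 + cr * c_A) := by positivity
  have hBE : B / E₀ ≤ c_B * (2 * (L + 2) ^ 4 * c' * Real.exp (-(5 * κ))) / E₀ := by
    rw [hB]; exact div_le_div_of_nonneg_right (mul_le_mul_of_nonneg_left h18 hcB) hE.le
  have h2 := mul_le_mul_of_nonneg_left hBE hX0
  have h4 : 1296 * K * (c₁ * c₂) * (1 / M ^ 4 + cr * c_A) * (c_B * (2 * (L + 2) ^ 4 * c' * Real.exp (-(5 * κ))) / E₀)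
      < 1 - 1 / L := by
    rw [← mul_div_assoc, div_lt_iff₀ hE]; linarith
  linarith

end Located

/-! ## §3 Numeric corners (no letter of Bałaban's is valued; two external engines reproduce the table, census sheet) -/

section Numeric

/-- (V1) at the least printed L = 13 ([I] p. 251 «L is an odd, positive integer > 11»), K = 8: `c₁c₂·cr·c_A < 1/5616`. [folklore] -/
example : (1 - 1 / 13) / (648 * 8) = (1 : ℝ) / 5616 := by norm_num

/-- (V1) at L = 13, K = 4 (bridge faces): `c₁c₂·cr·c_A < 1/2808`. [folklore] -/
example : (1 - 1 / 13) / (648 * 4) = (1 : ℝ) / 2808 := by norm_num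

/-- (V1) fires: at L = 13, K = 8, c₁ = c₂ = 1, a projection cost `cr·c_A = 1/5000 > 1/5616` leaves NO admissible M. [folklore] -/
example {M : ℝ} (hM : 0 < M) :
    ¬ (648 * 8 * ((1 : ℝ) * 1) * (1 + 1 * (1 / 5000) * M ^ 4) < (1 - 1 / 13) * M ^ 4) := by
  intro h
  have h' := not_rescued_by_M (K := 8) (L := 13) (c₁ := 1) (c₂ := 1) (cr := 1) (c_A := 1 / 5000)
    (by norm_num) hM (by norm_num) (by norm_num) h
  norm_num at h'

/-- (V2) corner, K = 8, L = M = 13, c₁c₂ = c′ = c_B = E₀ = 1, cr·c_A = 1: the κ-clause's threshold `T = 2592·8·15⁴·(1/13⁴ + 1)/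
(1 − 1/13) = 2498603760000/2197` (≈ 1.137·10⁹). [folklore] -/
example : 2592 * 8 * ((1 : ℝ) * 1) * 1 * 1 * (13 + 2) ^ 4 * (1 / 13 ^ 4 + 1 * 1) / (1 - 1 / 13) =
    2498603760000 / 2197 := by norm_num

/-- … κ = 4 FAILS the clause: `e^{20} < 2498603760000/2197` (Mathlib's `exp 1 < 2.7182818286 < 2.72`). [folklore] -/
example : Real.exp (5 * 4) < 2498603760000 / 2197 := by
  have h1 : Real.exp 1 < 272 / 100 := lt_trans Real.exp_one_lt_d9 (by norm_num)
  have h20 : Real.exp (5 * 4) = Real.exp 1 ^ 20 := by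
    rw [Real.exp_one_pow]; norm_num
  rw [h20]
  calc Real.exp 1 ^ 20 < (272 / 100 : ℝ) ^ 20 := by gcongr
    _ < 2498603760000 / 2197 := by norm_num

/-- … κ = 5 HOLDS: `2498603760000/2197 < e^{25}` (`2.7 < 2.7182818283 < exp 1`); so κ_min = 5 here (c = 0 value: 3, leaf-10's
Table C) — M-free (the engines give the same κ_min at M = 169). [folklore] -/
example : (2498603760000 : ℝ) / 2197 < Real.exp (5 * 5) := by
  have h1 : (27 : ℝ) / 10 < Real.exp 1 := lt_trans (by norm_num) Real.exp_one_gt_d9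
  have h25 : Real.exp (5 * 5) = Real.exp 1 ^ 25 := by
    rw [Real.exp_one_pow]; norm_num
  rw [h25]
  calc (2498603760000 : ℝ) / 2197 < (27 / 10 : ℝ) ^ 25 := by norm_num
    _ < Real.exp 1 ^ 25 := by gcongr

/-- (V2) corner through the theorem: at these letters `fade_of_p18_AW`'s κ-clause at κ = 5 is met, so the corrected rate fades for
every admissible α₄, M = 13, a ≤ M⁴ and every budget `B = C₃ε₁ ≤ 2·15⁴·e^{−25}`. [folklore] -/
example {α₄ B a C3e : ℝ} (hα₄ : 0 ≤ α₄) (h20 : (13 * 13 : ℝ) ^ 4 * α₄ ≤ 1) (ha : a ≤ 1 * (13 : ℝ) ^ 4) (hC3e : 0 ≤ C3e)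
    (hB : B = 1 * C3e) (h18 : C3e ≤ 2 * (13 + 2) ^ 4 * 1 * Real.exp (-(5 * 5))) :
    1 / 13 + 8 * (1 * α₄ / 1) * B * ((1 + 1 * a) * (1 * (6 * 13) ^ 4)) < 1 := by
  refine fade_of_p18_AW (K := 8) (L := 13) (M := 13) (E₀ := 1) (c₁ := 1) (c₂ := 1) (cr := 1) (c_A := 1) (c_B := 1)
    (c' := 1) (κ := 5) (by norm_num) (by norm_num) (by norm_num) (by norm_num) (by norm_num) hα₄ h20 (by norm_num)
    (by norm_num) ha (by norm_num) hC3e hB h18 ?_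
  rw [kappaClause_iff]
  have hT : 2592 * 8 * ((1 : ℝ) * 1) * 1 * 1 * (13 + 2) ^ 4 * (1 / 13 ^ 4 + 1 * 1) = 2498603760000 / 2197 * (1 - 1 / 13) := by
    norm_num
  have h1 : (27 : ℝ) / 10 < Real.exp 1 := lt_trans (by norm_num) Real.exp_one_gt_d9
  have h25 : Real.exp (5 * 5) = Real.exp 1 ^ 25 := by
    rw [Real.exp_one_pow]; norm_num
  rw [hT, h25]
  have hroom : (0 : ℝ) < 1 - 1 / 13 := by norm_num
  calc 2498603760000 / 2197 * (1 - 1 / 13) < (27 / 10 : ℝ) ^ 25 * (1 - 1 / 13) := by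
        apply mul_lt_mul_of_pos_right _ hroom; norm_num
    _ ≤ Real.exp 1 ^ 25 * (1 - 1 / 13) := by gcongr
    _ = (1 - 1 / 13) * 1 * Real.exp 1 ^ 25 := by ring

end Numeric

end Summit.QuantumFields.BalabanUV.T4Continuum.NE9ProjectionCostBudget

end
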